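import Mathlib.MeasureTheory.Constructions.HaarToSphere
import Mathlib.MeasureTheory.Measure.Lebesgue.VolumeOfBalls
import Mathlib.Analysis.SpecialFunctions.Complex.Arg
import Mathlib.MeasureTheory.Measure.CharacteristicFunction.Basic
import Mathlib.MeasureTheory.Group.Convolution
import Literature.Analysis.FunctionSpaces.UniformRandomWalkDensity
import Literature.Analysis.FunctionSpaces.BesselJPoissonIntegral
import HarnessLib

/-!
# Densities of short uniform random walks: the planar (Fourier) side of Kluyver's formula

Second sibling file of `Literature/Analysis/FunctionSpaces/UniformRandomWalkDensity.lean`, which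
vendors Borwein–Straub–Wan–Zudilin's evaluation of `p₄(1) = ∫₀^∞ t J₀(t)⁵ dt`
(`pearsonDensityFourAtOne`, Kluyver's Bessel integral [BorweinEtAl2012, eq. (2.1)] at `n = 4`,
`x = 1`). The printed proofs identify this Bessel integral with values of the DENSITIES of the
walk (`r_{5,0} = p₅'(0) = p₄(1)`, [BorweinEtAl2012, §5]) through Fourier analysis in the plane:
the position `S_n` of the `n`-step walk has characteristic function `J₀(‖ξ‖)ⁿ`, and Kluyver's
representation is its (radial) Fourier inversion. This file supplies that Fourier side, in the
plane modelled by `ℂ ≅ ℝ²` (real inner product `⟪z, w⟫ = Re(conj z · w)`, Lebesgue measure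
`volume`):

* `unitStepLaw` — the law of one uniform unit step (push-forward of `dθ/(2π)` on `(0, 2π]` under
  `θ ↦ e^{iθ}`), a probability measure; `uniformWalkLaw n` — the law of `S_n`, the `n`-fold
  convolution (`S_0 = 0`);
* `charFun_unitStepLaw : charFun unitStepLaw ξ = J₀(‖ξ‖)` — via rotation by `arg ξ` and Poisson's
  integral `∫₀^π cos(r cos θ) dθ = π J₀(r)` (tree: `integral_cos_mul_cos_eq_pi_mul_besselJ_zero`);
  hence `charFun_uniformWalkLaw : charFun (uniformWalkLaw n) ξ = J₀(‖ξ‖)ⁿ`;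
* `integral_besselJ_zero_norm_pow_five : ∫_{ℂ} J₀(‖ξ‖)⁵ dξ = 2π · pearsonDensityFourAtOne`
  (polar coordinates, Mathlib's `integral_fun_norm_addHaar`), i.e. Kluyver's number is
  `2π × [(2π)^{-2} ∫ φ_{S₅}]`, the would-be density of `S₅` at the origin times `2π`.

What is NOT here: the Fourier inversion of `uniformWalkLaw 5` (Mathlib has inversion for
functions, not for measures with integrable characteristic function) and everything downstream
(closed forms of `p₂`, `p₃`, the modular/CM evaluation); `BorweinStraubWanZudilin2012_thm9` stays a
named fact.

## References

* [BorweinEtAl2012] J. M. Borwein, A. Straub, J. Wan, W. Zudilin, Densities of short uniform random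
  walks, Canad. J. Math. 64 (2012) 961–990 = arXiv:1103.2995, §1 (the walk), §2 eq. (2.1)
  (Kluyver), §5 (`r_{5,0} = p₅'(0) = p₄(1)`).
* G. E. Andrews, R. Askey, R. Roy, *Special Functions*, (4.9.12) (Poisson's integral), as in
  `BesselJPoissonIntegral.lean`.
-/

noncomputable section

open _root_.MeasureTheory _root_.Set _root_.Real _root_.Complex
open scoped ENNReal RealInnerProductSpace ProbabilityTheory

namespace Literature.Analysis.FunctionSpaces

/-! ## Kluyver's integrand as a plane integral -/

/-- **`∫_{ℝ²} J₀(‖ξ‖)⁵ dξ = 2π ∫₀^∞ t J₀(t)⁵ dt`** (polar coordinates in the plane `ℂ ≅ ℝ²`):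
the plane integral of the fifth power of the characteristic function `J₀(‖ξ‖)` of a uniform unit
step equals `2π · pearsonDensityFourAtOne`. This is the first move of the Fourier-analytic reading
of Kluyver's formula (`p₄(1) = 2π × (2π)^{-2} ∫_{ℝ²} φ_{S₅}`, the density of the 5-step walk at the
origin). [folklore] -/
theorem integral_besselJ_zero_norm_pow_five :
    ∫ z : ℂ, besselJ 0 ‖z‖ ^ 5 = 2 * π * pearsonDensityFourAtOne := by
  have h := integral_fun_norm_addHaar (volume : Measure ℂ) (fun t : ℝ => besselJ 0 t ^ 5)
  rw [h, pearsonDensityFourAtOne, Complex.finrank_real_complex, Measure.real, Complex.volume_ball]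
  simp only [ENNReal.ofReal_one, one_pow, one_mul, ENNReal.coe_toReal, NNReal.coe_real_pi,
    Nat.add_one_sub_one, pow_one, smul_eq_mul, nsmul_eq_mul, Nat.cast_ofNat]
  ring

/-! ## The characteristic function of a uniform unit step is `J₀(‖ξ‖)` -/

/-- `∫₀^{2π} h(cos θ) dθ = ∫₀^π h(cos θ) dθ + ∫₀^π h(−cos θ) dθ` for continuous `h`. [folklore] -/
private theorem integral_comp_cos_zero_two_pi {h : ℝ → ℝ} (hh : Continuous h) :
    ∫ θ in (0 : ℝ)..2 * π, h (Real.cos θ) =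
      (∫ θ in (0 : ℝ)..π, h (Real.cos θ)) + ∫ θ in (0 : ℝ)..π, h (-Real.cos θ) := by
  have hc : Continuous fun θ : ℝ => h (Real.cos θ) := hh.comp continuous_cos
  rw [← intervalIntegral.integral_add_adjacent_intervals (b := π)
    (hc.intervalIntegrable 0 π) (hc.intervalIntegrable π (2 * π))]
  congr 1
  have := intervalIntegral.integral_comp_add_right (fun θ : ℝ => h (Real.cos θ)) π (a := 0) (b := π)
  simp only [zero_add] at this
  rw [show π + π = 2 * π by ring] at this
  rw [← this]
  refine intervalIntegral.integral_congr fun θ _ => ?_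
  simp [Real.cos_add_pi]

/-- `∫₀^{2π} cos(r cos θ) dθ = 2π J₀(r)` (Poisson's integral, doubled). [folklore] -/
theorem integral_cos_mul_cos_zero_two_pi (r : ℝ) :
    ∫ θ in (0 : ℝ)..2 * π, Real.cos (r * Real.cos θ) = 2 * π * besselJ 0 r := by
  have h := integral_comp_cos_zero_two_pi (h := fun u : ℝ => Real.cos (r * u)) (by fun_prop)
  rw [h]
  have h2 : ∫ θ in (0 : ℝ)..π, Real.cos (r * -Real.cos θ) =
      ∫ θ in (0 : ℝ)..π, Real.cos (r * Real.cos θ) := by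
    refine intervalIntegral.integral_congr fun θ _ => ?_
    simp [mul_neg, Real.cos_neg]
  rw [h2, integral_cos_mul_cos_eq_pi_mul_besselJ_zero]
  ring

/-- `∫₀^{2π} sin(r cos θ) dθ = 0` (odd under `θ ↦ θ + π`). [folklore] -/
theorem integral_sin_mul_cos_zero_two_pi (r : ℝ) :
    ∫ θ in (0 : ℝ)..2 * π, Real.sin (r * Real.cos θ) = 0 := by
  have h := integral_comp_cos_zero_two_pi (h := fun u : ℝ => Real.sin (r * u)) (by fun_prop)
  rw [h]
  have h2 : ∫ θ in (0 : ℝ)..π, Real.sin (r * -Real.cos θ) =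
      -∫ θ in (0 : ℝ)..π, Real.sin (r * Real.cos θ) := by
    rw [← intervalIntegral.integral_neg]
    refine intervalIntegral.integral_congr fun θ _ => ?_
    simp [mul_neg, Real.sin_neg]
  rw [h2]
  ring

/-- `∫₀^{2π} e^{i r cos θ} dθ = 2π J₀(r)`: the radial case of the unit-step characteristic
function. [folklore] -/
theorem integral_cexp_I_mul_cos_zero_two_pi (r : ℝ) :
    ∫ θ in (0 : ℝ)..2 * π, cexp (I * ((r * Real.cos θ : ℝ) : ℂ)) = 2 * π * besselJ 0 r := by
  have hrw : (fun θ : ℝ => cexp (I * ((r * Real.cos θ : ℝ) : ℂ))) =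
      fun θ : ℝ =>
        ((Real.cos (r * Real.cos θ) : ℝ) : ℂ) + ((Real.sin (r * Real.cos θ) : ℝ) : ℂ) * I := by
    funext θ
    rw [mul_comm, Complex.exp_mul_I, Complex.ofReal_cos, Complex.ofReal_sin]
  rw [hrw, intervalIntegral.integral_add, intervalIntegral.integral_mul_const,
    intervalIntegral.integral_ofReal, intervalIntegral.integral_ofReal,
    integral_cos_mul_cos_zero_two_pi, integral_sin_mul_cos_zero_two_pi]
  · push_cast; ring
  · exact (Complex.continuous_ofReal.comp (by fun_prop)).intervalIntegrable _ _
  · exact ((Complex.continuous_ofReal.comp (by fun_prop)).mul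
      continuous_const).intervalIntegrable _ _

/-- **The characteristic function of a uniform unit step is `J₀(‖ξ‖)`**: for every `ξ ∈ ℂ ≅ ℝ²`,
`∫₀^{2π} exp(i ⟪e^{iθ}, ξ⟫) dθ = 2π J₀(‖ξ‖)`, where `⟪e^{iθ}, ξ⟫ = Re ξ cos θ + Im ξ sin θ` is the
real inner product. Proof: rotate by `arg ξ` (periodicity) and use Poisson's integral
`∫₀^π cos(r cos θ) dθ = π J₀(r)`; the sine part vanishes. This is the input `φ_{step}(ξ) = J₀(|ξ|)`
behind Kluyver's Bessel representation of the random-walk densities.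
[cite: BorweinEtAl2012, §2 eq. (2.1)] -/
theorem integral_cexp_I_mul_inner_unitStep (ξ : ℂ) :
    ∫ θ in (0 : ℝ)..2 * π, cexp (I * ((ξ.re * Real.cos θ + ξ.im * Real.sin θ : ℝ) : ℂ)) =
      2 * π * besselJ 0 ‖ξ‖ := by
  set r : ℝ := ‖ξ‖ with hr
  set α : ℝ := Complex.arg ξ with hα
  set F : ℝ → ℂ := fun θ => cexp (I * ((r * Real.cos θ : ℝ) : ℂ)) with hF
  have hper : Function.Periodic F (2 * π) := fun θ => by
    simp only [hF, Real.cos_add_two_pi]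
  have hpt : ∀ θ : ℝ, ξ.re * Real.cos θ + ξ.im * Real.sin θ = r * Real.cos (θ - α) := by
    intro θ
    rw [Real.cos_sub, hr, hα, mul_add, ← mul_assoc, ← mul_assoc, mul_right_comm _ (Real.cos θ),
      mul_right_comm _ (Real.sin θ), Complex.norm_mul_cos_arg, Complex.norm_mul_sin_arg]
  have h1 : (fun θ : ℝ => cexp (I * ((ξ.re * Real.cos θ + ξ.im * Real.sin θ : ℝ) : ℂ))) =
      fun θ => F (θ - α) := by
    funext θ; simp only [hF, hpt θ]
  rw [h1, intervalIntegral.integral_comp_sub_right F α,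
    show 2 * π - α = (0 - α) + 2 * π by ring, hper.intervalIntegral_add_eq (0 - α) 0, zero_add]
  exact integral_cexp_I_mul_cos_zero_two_pi r

/-! ## The law of a uniform unit step and of the `n`-step walk; their characteristic functions -/

/-- **The law of one uniform unit step in the plane** `ℂ ≅ ℝ²`: the push-forward of Lebesgue
measure on `(0, 2π]` under `θ ↦ e^{iθ}`, normalised by `1/(2π)` — "a step of length `1` taken
into a uniformly random direction" [BorweinEtAl2012, §1]. [cite: BorweinEtAl2012, §1] -/
def unitStepLaw : Measure ℂ :=
  ENNReal.ofReal (2 * π)⁻¹ •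
    Measure.map (fun θ : ℝ => cexp (θ * I)) (volume.restrict (Ioc (0 : ℝ) (2 * π)))

/-- Integration against the unit-step law is the normalised angular average. [folklore] -/
theorem integral_unitStepLaw (g : ℂ → ℂ) (hg : Continuous g) :
    ∫ z, g z ∂unitStepLaw = (2 * π)⁻¹ * ∫ θ in (0 : ℝ)..2 * π, g (cexp (θ * I)) := by
  have hmeas : AEMeasurable (fun θ : ℝ => cexp (θ * I)) (volume.restrict (Ioc (0 : ℝ) (2 * π))) :=
    (Complex.continuous_exp.comp (Complex.continuous_ofReal.mul continuous_const)).measurable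
      |>.aemeasurable
  rw [unitStepLaw, integral_smul_measure, integral_map hmeas hg.aestronglyMeasurable,
    intervalIntegral.integral_of_le (by positivity : (0 : ℝ) ≤ 2 * π),
    ENNReal.toReal_ofReal (by positivity : (0 : ℝ) ≤ (2 * π)⁻¹)]
  rfl

/-- The unit-step law is a probability measure (`|(0, 2π]| · (2π)⁻¹ = 1`). [folklore] -/
instance isProbabilityMeasure_unitStepLaw : IsProbabilityMeasure unitStepLaw := by
  constructor
  have hmeas : AEMeasurable (fun θ : ℝ => cexp (θ * I)) (volume.restrict (Ioc (0 : ℝ) (2 * π))) :=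
    (Complex.continuous_exp.comp (Complex.continuous_ofReal.mul continuous_const)).measurable
      |>.aemeasurable
  rw [unitStepLaw, Measure.smul_apply, Measure.map_apply_of_aemeasurable hmeas MeasurableSet.univ,
    Set.preimage_univ, Measure.restrict_apply MeasurableSet.univ, Set.univ_inter, Real.volume_Ioc,
    smul_eq_mul, ← ENNReal.ofReal_mul (by positivity), sub_zero,
    inv_mul_cancel₀ (by positivity : (2 * π : ℝ) ≠ 0), ENNReal.ofReal_one]

/-- The real inner product of `e^{iθ}` with `ξ` in `ℂ ≅ ℝ²` is `Re ξ cos θ + Im ξ sin θ`.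
[folklore] -/
theorem inner_cexp_mul_I (θ : ℝ) (ξ : ℂ) :
    ⟪cexp (θ * I), ξ⟫ = ξ.re * Real.cos θ + ξ.im * Real.sin θ := by
  rw [Complex.inner, Complex.mul_re, Complex.conj_re, Complex.conj_im, exp_ofReal_mul_I_re,
    exp_ofReal_mul_I_im]
  ring

/-- **The characteristic function of a uniform unit step is `ξ ↦ J₀(‖ξ‖)`** (the Fourier-side
content of Kluyver's representation [BorweinEtAl2012, eq. (2.1)]: the `n`-step position then has
characteristic function `J₀(‖ξ‖)ⁿ`). [cite: BorweinEtAl2012, §2 eq. (2.1)] -/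
theorem charFun_unitStepLaw (ξ : ℂ) : charFun unitStepLaw ξ = besselJ 0 ‖ξ‖ := by
  rw [charFun_apply, integral_unitStepLaw _ (by fun_prop)]
  have h : (fun θ : ℝ => cexp ((⟪cexp (θ * I), ξ⟫ : ℝ) * I)) =
      fun θ : ℝ => cexp (I * ((ξ.re * Real.cos θ + ξ.im * Real.sin θ : ℝ) : ℂ)) := by
    funext θ; rw [inner_cexp_mul_I, mul_comm]
  rw [h, integral_cexp_I_mul_inner_unitStep]
  have hπ : (2 * π : ℂ) ≠ 0 := by exact_mod_cast (by positivity : (2 * π : ℝ) ≠ 0)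
  push_cast
  field_simp

/-- **The law of the endpoint `S_n` of the `n`-step uniform planar random walk** started at the
origin: the `n`-fold additive convolution of `unitStepLaw` (`S_0 = 0`).
[cite: BorweinEtAl2012, §1] -/
def uniformWalkLaw : ℕ → Measure ℂ
  | 0 => Measure.dirac 0
  | n + 1 => uniformWalkLaw n ∗ unitStepLaw

/-- `S_0 = 0`. [folklore] -/
@[simp] theorem uniformWalkLaw_zero : uniformWalkLaw 0 = Measure.dirac 0 := rfl

/-- `S_{n+1} = S_n + (independent uniform unit step)`. [folklore] -/
theorem uniformWalkLaw_succ (n : ℕ) :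
    uniformWalkLaw (n + 1) = uniformWalkLaw n ∗ unitStepLaw := rfl

/-- The law of `S_n` is a probability measure. [folklore] -/
instance isProbabilityMeasure_uniformWalkLaw (n : ℕ) : IsProbabilityMeasure (uniformWalkLaw n) := by
  induction n with
  | zero => rw [uniformWalkLaw_zero]; infer_instance
  | succ n ih => rw [uniformWalkLaw_succ]; infer_instance

/-- **Characteristic function of the `n`-step walk**: `φ_{S_n}(ξ) = J₀(‖ξ‖)ⁿ` — the statement
whose Fourier inversion is Kluyver's Bessel-integral representation of the densities `p_n`
[BorweinEtAl2012, eq. (2.1)]. [cite: BorweinEtAl2012, §2 eq. (2.1)] -/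
theorem charFun_uniformWalkLaw (n : ℕ) (ξ : ℂ) :
    charFun (uniformWalkLaw n) ξ = (besselJ 0 ‖ξ‖ : ℂ) ^ n := by
  induction n with
  | zero => simp [charFun_dirac]
  | succ n ih => rw [uniformWalkLaw_succ, charFun_conv, ih, charFun_unitStepLaw, pow_succ]

end Literature.Analysis.FunctionSpaces

end
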